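import Literature.Combinatorics.SimpleGraph.MatchingDigraph
import Literature.Combinatorics.SimpleGraph.ClosedWalkCycles
import Literature.Combinatorics.SimpleGraph.PfaffianCertificate
import HarnessLib

/-!
# The last ear of a minimal non-Pfaffian bipartite graph

Topic `Combinatorics/SimpleGraph`; theorems only. A step of the hard direction of Little's theorem
(`Little1975_isPfaffianBipartite_iff_not_isMatchingMinor`, `LittleTheorem.lean`), in the setting
of `LittleTheoremReduction.lean`: `G ⊆ Fin n × Fin n` contains the diagonal (the reference perfect
matching), is not Pfaffian, but `G.erase e` is Pfaffian for every `e ∈ G`; directed circuits of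
`D(G, M)` are cyclic permutations inside `G`, arcs are `IsArc G` (`MatchingDigraph.lean`).

Let `u → v` be an arc such that `D(G, M)` minus this arc is still strongly connected (a
"removable" arc / last single ear; `RemovableArc.lean`). Following Little (1975, §4: the sets
`X ∪ Y ∪ f(P)`, `S`) and the ear-decomposition proof of Norine–Little–Teo, we prove
`exists_ear_structure`:

1. (`exists_opposite_pair`) a signing `s` (`+1` on the diagonal and on `(u, v)`) under which every
   directed circuit avoiding the arc `u → v` is positive (from Pfaffian-ness of `G.erase (u, v)`,
   `isPfaffianBipartite_iff_forall_isCycle`), together with two directed circuits `A`, `B` through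
   `u → v` (`A u = v = B u`) of OPPOSITE weights `-1`, `+1` (from non-Pfaffian-ness of `G`, trying
   both values of the signing on `(u, v)`);
2. a directed path `S` from `u` to `v` avoiding the arc (strong connectivity);
3. **every arc of `D(G, M)` is an arc of `A`, of `B`, or of `S`.** Proof: the closed walks
   `(A - uv) · S` and `(B - uv) · S` decompose modulo 2 into directed circuits
   (`exists_cyclePerms_of_closedWalk`), all avoiding `u → v`, hence positive; together with `A`
   and `B` they form a family covering every arc an even number of times whose weights multiply
   to `-1`, i.e. a certificate of non-Pfaffian-ness (`not_isPfaffianBipartite_of_certificate`)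
   living inside the subgraph `diagonal ∪ A ∪ B ∪ S`; by deletion-minimality that subgraph is all
   of `G`.

## References

* C. H. C. Little, *A characterization of convertible (0,1)-matrices*, J. Combin. Theory Ser. B
  18 (1975) 187–208, §4. [Little1975]
* N. Robertson, P. D. Seymour, R. Thomas, *Permanents, Pfaffian orientations, and even directed
  circuits*, Ann. of Math. 150 (1999) 929–975, §7. [RobertsonSeymourThomas1999]
* I. Fischer, C. H. C. Little, *A characterisation of Pfaffian near bipartite graphs*, J. Combin.
  Theory Ser. B 82 (2001) 175–222, §2 (ear decompositions, intractable sets). [FischerLittle2001]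
-/

namespace Literature.Combinatorics.SimpleGraph

open Equiv Finset

variable {n : ℕ}

/-! ### Weights under a modified signing -/

/-- A non-Pfaffian `G ⊇ diagonal` has, under ANY normalised signing, a directed circuit of weight
`-1` (contrapositive of `isPfaffianBipartite_iff_forall_isCycle`). [folklore] -/
theorem exists_isCycle_weight_eq_neg_one {G : Finset (Fin n × Fin n)} (hdiag : ∀ i, (i, i) ∈ G)
    (hG : ¬ IsPfaffianBipartite G) (s : Fin n × Fin n → ℤˣ) (h1 : ∀ i, s (i, i) = 1) :
    ∃ γ : Perm (Fin n), γ.IsCycle ∧ (∀ i, (i, γ i) ∈ G) ∧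
      Perm.sign γ * ∏ i, s (i, γ i) = -1 := by
  by_contra h
  apply hG
  rw [isPfaffianBipartite_iff_forall_isCycle hdiag]
  refine ⟨s, h1, fun γ hγ hmem => ?_⟩
  rcases Int.units_eq_one_or (Perm.sign γ * ∏ i, s (i, γ i)) with h' | h'
  · exact h'
  · exact (h ⟨γ, hγ, hmem, h'⟩).elim

/-- The product of a signing changed at the cell `(u, v)` along a permutation NOT using that
cell is unchanged. [folklore] -/
theorem prod_update_of_apply_ne (s : Fin n × Fin n → ℤˣ) {u v : Fin n} (c : ℤˣ)
    (γ : Perm (Fin n)) (hγ : γ u ≠ v) :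
    ∏ i, Function.update s (u, v) c (i, γ i) = ∏ i, s (i, γ i) := by
  refine Finset.prod_congr rfl fun i _ => Function.update_of_ne (fun h => ?_) _ _
  obtain ⟨rfl, h2⟩ := Prod.ext_iff.1 h
  exact hγ h2

/-- The product of a signing changed at the cell `(u, v)` along a permutation USING that cell:
the new value times the product over the other rows. [folklore] -/
theorem prod_update_of_apply_eq (s : Fin n × Fin n → ℤˣ) {u v : Fin n} (c : ℤˣ)
    (γ : Perm (Fin n)) (hγ : γ u = v) :
    ∏ i, Function.update s (u, v) c (i, γ i) = c * ∏ i ∈ Finset.univ.erase u, s (i, γ i) := by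
  rw [← Finset.mul_prod_erase Finset.univ _ (Finset.mem_univ u)]
  congr 1
  · rw [hγ, Function.update_self]
  · refine Finset.prod_congr rfl fun i hi => Function.update_of_ne (fun h => ?_) _ _
    exact Finset.ne_of_mem_erase hi (Prod.ext_iff.1 h).1

/-- **The opposite pair through a removable arc.** Let `G ⊇ diagonal` be non-Pfaffian with
`G.erase (u, v)` Pfaffian, `u ≠ v`. Then there are a signing `s`, equal to `+1` on the diagonal
and on `(u, v)`, under which every directed circuit avoiding the cell `(u, v)` is positive, and
two directed circuits `A`, `B` of `D(G, M)` through the arc `u → v` with weights `-1` and `+1`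
(Little 1975, §4: the sets `X, Y` of `α`-paths of the two types; both types occur since otherwise
the signing extends to `G`). [cite: Little1975, §4] -/
theorem exists_opposite_pair {G : Finset (Fin n × Fin n)} (hdiag : ∀ i, (i, i) ∈ G)
    (hG : ¬ IsPfaffianBipartite G) {u v : Fin n} (huv : u ≠ v)
    (hdel : IsPfaffianBipartite (G.erase (u, v))) :
    ∃ (s : Fin n × Fin n → ℤˣ) (A B : Perm (Fin n)), (∀ i, s (i, i) = 1) ∧ s (u, v) = 1 ∧
      (∀ γ : Perm (Fin n), γ.IsCycle → (∀ i, (i, γ i) ∈ G) → γ u ≠ v →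
        Perm.sign γ * ∏ i, s (i, γ i) = 1) ∧
      A.IsCycle ∧ (∀ i, (i, A i) ∈ G) ∧ A u = v ∧ Perm.sign A * ∏ i, s (i, A i) = -1 ∧
      B.IsCycle ∧ (∀ i, (i, B i) ∈ G) ∧ B u = v ∧ Perm.sign B * ∏ i, s (i, B i) = 1 := by
  have hdiag' : ∀ i, (i, i) ∈ G.erase (u, v) := fun i =>
    Finset.mem_erase.2 ⟨fun he => huv ((Prod.ext_iff.1 he).1.symm.trans (Prod.ext_iff.1 he).2),
      hdiag i⟩
  obtain ⟨s₀, h1, hpos⟩ := (isPfaffianBipartite_iff_forall_isCycle hdiag').1 hdel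
  -- circuits avoiding the cell `(u, v)` lie inside `G.erase (u, v)`
  have hinside : ∀ γ : Perm (Fin n), (∀ i, (i, γ i) ∈ G) → γ u ≠ v →
      ∀ i, (i, γ i) ∈ G.erase (u, v) := by
    intro γ hmem hγ i
    refine Finset.mem_erase.2 ⟨fun he => ?_, hmem i⟩
    obtain ⟨rfl, h2⟩ := Prod.ext_iff.1 he
    exact hγ h2
  have hdiag1 : ∀ (c : ℤˣ) (i : Fin n), Function.update s₀ (u, v) c (i, i) = 1 := by
    intro c i
    rw [Function.update_of_ne (fun h => huv ((Prod.ext_iff.1 h).1.symm.trans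
      (Prod.ext_iff.1 h).2)), h1]
  -- the signing `s₊ := s₀[(u,v) ↦ 1]`
  set s := Function.update s₀ (u, v) 1 with hs
  have hspos : ∀ γ : Perm (Fin n), γ.IsCycle → (∀ i, (i, γ i) ∈ G) → γ u ≠ v →
      Perm.sign γ * ∏ i, s (i, γ i) = 1 := by
    intro γ hγ hmem hγu
    rw [hs, prod_update_of_apply_ne s₀ 1 γ hγu]
    exact hpos γ hγ (hinside γ hmem hγu)
  -- `A`: a negative circuit under `s₊`; it must use the cell `(u, v)`
  obtain ⟨A, hA, hAmem, hAw⟩ := exists_isCycle_weight_eq_neg_one hdiag hG s (hdiag1 1)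
  have hAu : A u = v := by
    by_contra hAu
    have := hspos A hA hAmem hAu
    rw [this] at hAw
    exact absurd hAw (by decide)
  -- `B`: a negative circuit under `s₋ := s₀[(u,v) ↦ -1]`; it uses `(u, v)`, so it is positive
  -- under `s₊`
  obtain ⟨B, hB, hBmem, hBw⟩ :=
    exists_isCycle_weight_eq_neg_one hdiag hG (Function.update s₀ (u, v) (-1)) (hdiag1 (-1))
  have hBu : B u = v := by
    by_contra hBu
    rw [prod_update_of_apply_ne s₀ (-1) B hBu] at hBw
    have := hpos B hB (hinside B hBmem hBu)
    rw [this] at hBw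
    exact absurd hBw (by decide)
  have hBw' : Perm.sign B * ∏ i, s (i, B i) = 1 := by
    rw [prod_update_of_apply_eq s₀ (-1) B hBu] at hBw
    rw [hs, prod_update_of_apply_eq s₀ 1 B hBu, one_mul]
    -- `sign B * (-1 * P) = -1` gives `sign B * P = 1`
    have h := congrArg (fun x : ℤˣ => -x) hBw
    simp only [neg_neg] at h
    rw [← h]
    simp
  refine ⟨s, A, B, hdiag1 1, ?_, hspos, hA, hAmem, hAu, hAw, hB, hBmem, hBu, hBw'⟩
  rw [hs, Function.update_self]

/-! ### The vertex list of a directed circuit -/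

/-- **The vertex list of a directed circuit through `u → v`, started at `v`**: for a cyclic
permutation `A` with `A u = v`, `u ≠ v`, the list `c = A.toList v = [v, A v, …, u]` has no
repeated vertex, `c.formPerm = A`, it starts at `v` and ends at `u`. [folklore] -/
theorem toList_of_apply_eq {A : Perm (Fin n)} (hA : A.IsCycle) {u v : Fin n} (huv : u ≠ v)
    (hAu : A u = v) :
    2 ≤ (A.toList v).length ∧ (A.toList v).Nodup ∧ (A.toList v).formPerm = A ∧
      (A.toList v).head? = some v ∧ (A.toList v).getLast? = some u := by
  have hv : A v ≠ v := by
    intro h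
    exact huv (A.injective (hAu.trans h.symm))
  have hvs : v ∈ A.support := Perm.mem_support.2 hv
  have h2 : 2 ≤ (A.toList v).length := Perm.two_le_length_toList_iff_mem_support.2 hvs
  have hne : A.toList v ≠ [] := List.ne_nil_of_length_pos (by omega)
  have hform : (A.toList v).formPerm = A := by rw [Perm.formPerm_toList, hA.cycleOf_eq hv]
  have hhead : (A.toList v).head hne = v := by
    rw [List.head_eq_getElem]; exact Perm.toList_getElem_zero _ _ hvs
  refine ⟨h2, Perm.nodup_toList A v, hform, ?_, ?_⟩
  · rw [List.head?_eq_some_head hne, hhead]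
  · rw [List.getLast?_eq_getLast_of_ne_nil hne]
    congr 1
    apply A.injective
    obtain ⟨x, xs, hx⟩ := List.exists_cons_of_ne_nil hne
    have hlast := List.formPerm_apply_getLast x xs
    have hx' : x = v := by
      rw [← hhead]; simp only [hx, List.head_cons]
    simp only [← hx, hform] at hlast
    rw [hAu, hlast, hx']

/-- The arcs of the OPEN path `c = [v, …, u]` of a circuit `A` through `u → v` together with the
arc `(u, v)` are the cells `(x, A x)`: `c.zip c.tail ++ [(u, v)] = c.map (x ↦ (x, A x))`.
[folklore] -/
theorem zip_tail_toList {A : Perm (Fin n)} (hA : A.IsCycle) {u v : Fin n} (huv : u ≠ v)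
    (hAu : A u = v) :
    (A.toList v).zip (A.toList v).tail ++ [(u, v)] = (A.toList v).map fun x => (x, A x) := by
  obtain ⟨h2, hnd, hform, hhead, hlast⟩ := toList_of_apply_eq hA huv hAu
  set L := A.toList v with hL
  have hne : L ≠ [] := List.ne_nil_of_length_pos (by omega)
  have htake : L.take 1 = [v] := by
    rw [List.take_one, hhead, Option.toList_some]
  have h := zip_tail_cycle_eq_map_formPerm L hnd h2
  rw [hform, htake, zip_tail_append L [v] hne (List.cons_ne_nil _ _)] at h
  rw [← h]
  congr 1
  rw [List.getLast?_eq_getLast_of_ne_nil hne, Option.some_inj] at hlast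
  simp [hlast]

/-- Counting the arcs of the open path of a circuit `A` through `u → v`: for `a ≠ b`, the number
of times `(a, b)` is an arc of `[v, …, u]`, plus one if `(a, b) = (u, v)`, is `1` if `A a = b`
and `0` otherwise. [folklore] -/
theorem count_zip_tail_toList {A : Perm (Fin n)} (hA : A.IsCycle) {u v : Fin n} (huv : u ≠ v)
    (hAu : A u = v) {a b : Fin n} (hab : a ≠ b) :
    ((A.toList v).zip (A.toList v).tail).count (a, b) + (if (a, b) = (u, v) then 1 else 0) =
      if A a = b then 1 else 0 := by
  obtain ⟨h2, hnd, hform, -, -⟩ := toList_of_apply_eq hA huv hAu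
  have h := count_zip_tail_cycle (A.toList v) hnd h2 hab
  rw [zip_tail_cycle_eq_map_formPerm _ hnd h2, hform, ← zip_tail_toList hA huv hAu,
    List.count_append, List.count_singleton] at h
  rw [← h]
  congr 1
  by_cases hp : (a, b) = (u, v)
  · rw [if_pos hp, if_pos (beq_iff_eq.2 hp.symm)]
  · rw [if_neg hp, if_neg (fun h' => hp (beq_iff_eq.1 h').symm)]

/-- An arc of the open path `[v, …, u]` of the circuit `A` is a cell of `A`. [folklore] -/
theorem apply_eq_of_mem_zip_tail_toList {A : Perm (Fin n)} (hA : A.IsCycle) {u v : Fin n}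
    (huv : u ≠ v) (hAu : A u = v) {p : Fin n × Fin n}
    (hp : p ∈ (A.toList v).zip (A.toList v).tail) : A p.1 = p.2 := by
  have h : p ∈ (A.toList v).map fun x => (x, A x) := by
    rw [← zip_tail_toList hA huv hAu]
    exact List.mem_append_left _ hp
  obtain ⟨x, -, rfl⟩ := List.mem_map.1 h
  rfl

/-- The open path `[v, …, u]` of a circuit `A` of `D(G, M)` through `u → v` is a chain of arcs
of `G.erase (u, v)`. [folklore] -/
theorem isChain_toList {G : Finset (Fin n × Fin n)} {A : Perm (Fin n)} (hA : A.IsCycle)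
    (hAmem : ∀ i, (i, A i) ∈ G) {u v : Fin n} (huv : u ≠ v) (hAu : A u = v) :
    (A.toList v).IsChain (IsArc (G.erase (u, v))) := by
  obtain ⟨h2, hnd, hform, -, hlast⟩ := toList_of_apply_eq hA huv hAu
  set L := A.toList v with hL
  rw [List.isChain_iff_getElem]
  intro k hk
  -- the `k`-th arc is `(L[k], A L[k])`, and `L[k] ≠ u` since `u` is the last vertex
  have hk' : k < L.length := Nat.lt_of_succ_lt hk
  have hmem : (L[k], L[k + 1]) ∈ L.zip L.tail := by
    rw [List.mem_iff_getElem]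
    refine ⟨k, by simp; omega, ?_⟩
    rw [List.getElem_zip]
    simp
  have hAk : A L[k] = L[k + 1] := apply_eq_of_mem_zip_tail_toList hA huv hAu hmem
  refine isArc_erase_iff.2 ⟨⟨fun heq => ?_, ?_⟩, fun heq => ?_⟩
  · exact absurd heq (hnd.getElem_inj_iff.not.2 (by omega))
  · rw [← hAk]; exact hAmem _
  · -- `L[k] = u` forces `k = length - 1`
    have hku : L[k] = u := (Prod.ext_iff.1 heq).1
    have hne : L ≠ [] := List.ne_nil_of_length_pos (by omega)
    rw [List.getLast?_eq_getLast_of_ne_nil hne, Option.some_inj, List.getLast_eq_getElem] at hlast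
    rw [← hlast] at hku
    have := hnd.getElem_inj_iff.1 hku
    omega

/-! ### The ear structure theorem -/

/-- Parity bookkeeping for the certificate. [folklore] -/
private theorem even_of_counts {iA iB cA cB cS δ g₁ g₂ : ℕ} (hA : cA + δ = iA) (hB : cB + δ = iB)
    (h₁ : (cA + cS) % 2 = g₁ % 2) (h₂ : (cB + cS) % 2 = g₂ % 2) :
    Even (g₁ + g₂ + iB + iA) := by
  rw [Nat.even_iff]; omega

/-- **The covering property of an opposite pair and a return path** (Little 1975, §4;
Norine–Little–Teo). Let `G ⊇ diagonal` be non-Pfaffian with `G.erase e` Pfaffian for all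
`e ∈ G`, `u → v` an arc, `s` a signing (`+1` on the diagonal) making every directed circuit
avoiding the cell `(u, v)` positive, `A` and `B` ANY directed circuits through `u → v` of weights
`-1` and `+1`, and `S = u :: lS` ANY directed path from `u` to `v` avoiding the arc. Then **every
arc `a → b` of `D(G, M)` is an arc of `A`, of `B` or of `S`**: the closed walks `(A - uv) · S`,
`(B - uv) · S` decompose modulo 2 into (positive) circuits avoiding `u → v`, which together with
`A`, `B` form a certificate of non-Pfaffian-ness inside `diagonal ∪ A ∪ B ∪ S`; by
deletion-minimality that subgraph is `G`. [cite: Little1975, §4] -/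
theorem covering_of_triple {G : Finset (Fin n × Fin n)} (hdiag : ∀ i, (i, i) ∈ G)
    (hdel : ∀ e ∈ G, IsPfaffianBipartite (G.erase e)) {u v : Fin n} (huv : IsArc G u v)
    {s : Fin n × Fin n → ℤˣ} (h1 : ∀ i, s (i, i) = 1)
    (hpos : ∀ γ : Perm (Fin n), γ.IsCycle → (∀ i, (i, γ i) ∈ G) → γ u ≠ v →
      Perm.sign γ * ∏ i, s (i, γ i) = 1)
    {A : Perm (Fin n)} (hA : A.IsCycle) (hAmem : ∀ i, (i, A i) ∈ G) (hAu : A u = v)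
    (hAw : Perm.sign A * ∏ i, s (i, A i) = -1)
    {B : Perm (Fin n)} (hB : B.IsCycle) (hBmem : ∀ i, (i, B i) ∈ G) (hBu : B u = v)
    (hBw : Perm.sign B * ∏ i, s (i, B i) = 1)
    {lS : List (Fin n)} (hSchain : (u :: lS).IsChain (IsArc (G.erase (u, v))))
    (hSlast : (u :: lS).getLast (List.cons_ne_nil _ _) = v) :
    ∀ a b, IsArc G a b → A a = b ∨ B a = b ∨ (a, b) ∈ (u :: lS).zip lS := by
  classical
  -- `lS ≠ []` since the path goes from `u` to `v ≠ u`
  obtain ⟨s₁, lS', rfl⟩ : ∃ s₁ lS', lS = s₁ :: lS' := by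
    cases lS with
    | nil => exact absurd hSlast.symm huv.1.symm
    | cons s₁ lS' => exact ⟨s₁, lS', rfl⟩
  set G' := G.erase (u, v) with hG'
  have hirr : ∀ x : Fin n, ¬ IsArc G' x x := fun x h => h.1 rfl
  -- the closed walks `(X - uv) · S` for `X = A, B`, decomposed into circuits of `G'`
  have hwalk : ∀ X : Perm (Fin n), X.IsCycle → (∀ i, (i, X i) ∈ G) → X u = v →
      ∃ Γ : List (Perm (Fin n)), (∀ σ ∈ Γ, σ.IsCycle ∧ (∀ a, σ a = a ∨ IsArc G' a (σ a)) ∧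
          ∀ a, σ a ≠ a → (a, σ a) ∈ (X.toList v).zip (X.toList v).tail ++
            (u :: s₁ :: lS').zip (s₁ :: lS')) ∧
        ∀ a b, a ≠ b → (((X.toList v).zip (X.toList v).tail).count (a, b) +
          ((u :: s₁ :: lS').zip (s₁ :: lS')).count (a, b)) % 2 =
            (Γ.countP fun σ => σ a = b) % 2 := by
    intro X hX hXmem hXu
    obtain ⟨h2, hnd, hform, hhead, hlast⟩ := toList_of_apply_eq hX huv.1 hXu
    have hne : X.toList v ≠ [] := List.ne_nil_of_length_pos (by omega)
    -- the walk
    have hW2 : 2 ≤ (X.toList v ++ s₁ :: lS').length := by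
      rw [List.length_append]; omega
    have hWchain : (X.toList v ++ s₁ :: lS').IsChain (IsArc G') := by
      refine List.IsChain.append (isChain_toList hX hXmem huv.1 hXu) hSchain.tail ?_
      intro x hx y hy
      rw [hlast, Option.mem_def, Option.some_inj] at hx
      simp only [List.head?_cons, Option.mem_def, Option.some_inj] at hy
      subst hx; subst hy
      exact (List.isChain_cons_cons.1 hSchain).1
    have hlS : (s₁ :: lS').getLast (List.cons_ne_nil _ _) = v := by
      rw [List.getLast_cons (List.cons_ne_nil _ _)] at hSlast
      exact hSlast
    have hlastu : (X.toList v).getLast hne = u := by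
      rw [List.getLast?_eq_getLast_of_ne_nil hne, Option.some_inj] at hlast
      exact hlast
    have hWclosed : (X.toList v ++ s₁ :: lS').head? = (X.toList v ++ s₁ :: lS').getLast? := by
      rw [List.head?_append, hhead, List.getLast?_append,
        List.getLast?_eq_getLast_of_ne_nil (List.cons_ne_nil _ _), hlS]
      rfl
    obtain ⟨Γ, hΓ, hcount⟩ := exists_cyclePerms_of_closedWalk hirr _ hW2 hWchain hWclosed
    have hzip : (X.toList v ++ s₁ :: lS').zip (X.toList v ++ s₁ :: lS').tail =
        (X.toList v).zip (X.toList v).tail ++ (u :: s₁ :: lS').zip (s₁ :: lS') := by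
      rw [zip_tail_append _ _ hne (List.cons_ne_nil _ _), hlastu]
      rfl
    refine ⟨Γ, fun σ hσ => ?_, fun a b hab => ?_⟩
    · obtain ⟨hσc, hσrel, hσmem⟩ := hΓ σ hσ
      exact ⟨hσc, hσrel, fun a ha => hzip ▸ hσmem a ha⟩
    · rw [← hcount a b hab, hzip, List.count_append]
  obtain ⟨Γ₁, hΓ₁, hc₁⟩ := hwalk A hA hAmem hAu
  obtain ⟨Γ₂, hΓ₂, hc₂⟩ := hwalk B hB hBmem hBu
  -- members of the decompositions lie inside `G` and avoid the cell `(u, v)`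
  have hin : ∀ σ : Perm (Fin n), (∀ a, σ a = a ∨ IsArc G' a (σ a)) →
      (∀ i, (i, σ i) ∈ G) ∧ σ u ≠ v := by
    intro σ hσ
    refine ⟨fun i => ?_, fun hσu => ?_⟩
    · rcases hσ i with h | h
      · rw [h]; exact hdiag i
      · exact Finset.mem_of_mem_erase h.2
    · rcases hσ u with h | h
      · exact huv.1 (h.symm.trans hσu)
      · rw [hσu] at h
        exact (isArc_erase_iff.1 h).2 rfl
  -- the certificate family
  set F : List (Perm (Fin n)) := A :: B :: (Γ₁ ++ Γ₂) with hF
  have hFcyc : ∀ γ ∈ F, γ.IsCycle := by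
    intro γ hγ
    simp only [hF, List.mem_cons, List.mem_append] at hγ
    rcases hγ with rfl | rfl | hγ | hγ
    exacts [hA, hB, (hΓ₁ γ hγ).1, (hΓ₂ γ hγ).1]
  have hFmem : ∀ γ ∈ F, ∀ i, (i, γ i) ∈ G := by
    intro γ hγ
    simp only [hF, List.mem_cons, List.mem_append] at hγ
    rcases hγ with rfl | rfl | hγ | hγ
    exacts [hAmem, hBmem, (hin γ (hΓ₁ γ hγ).2.1).1, (hin γ (hΓ₂ γ hγ).2.1).1]
  -- even coverage
  have heven : ∀ a b : Fin n, a ≠ b → Even (F.countP fun γ => γ a = b) := by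
    intro a b hab
    have hA' := count_zip_tail_toList hA huv.1 hAu hab
    have hB' := count_zip_tail_toList hB huv.1 hBu hab
    have h₁ := hc₁ a b hab
    have h₂ := hc₂ a b hab
    simp only [hF, List.countP_cons, List.countP_append, decide_eq_true_eq]
    exact even_of_counts hA' hB' h₁ h₂
  -- total weight `-1`, hence sign product `-1`
  have hΓw : ∀ Γ : List (Perm (Fin n)),
      (∀ σ ∈ Γ, σ.IsCycle ∧ (∀ a, σ a = a ∨ IsArc G' a (σ a))) →
      (Γ.map fun γ => Perm.sign γ * ∏ i, s (i, γ i)).prod = 1 := by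
    intro Γ hΓ
    apply List.prod_eq_one
    intro x hx
    obtain ⟨σ, hσ, rfl⟩ := List.mem_map.1 hx
    obtain ⟨hσc, hσrel⟩ := hΓ σ hσ
    exact hpos σ hσc (hin σ hσrel).1 (hin σ hσrel).2
  have hweights : (F.map fun γ => Perm.sign γ * ∏ i, s (i, γ i)).prod = -1 := by
    simp only [hF, List.map_cons, List.map_append, List.prod_cons, List.prod_append]
    rw [hΓw Γ₁ (fun σ hσ => ⟨(hΓ₁ σ hσ).1, (hΓ₁ σ hσ).2.1⟩),
      hΓw Γ₂ (fun σ hσ => ⟨(hΓ₂ σ hσ).1, (hΓ₂ σ hσ).2.1⟩), hAw, hBw]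
    simp
  have hsign : (F.map fun γ => (Perm.sign γ : ℤˣ)).prod = -1 := by
    rw [← prod_weight_eq_prod_sign F heven s h1, hweights]
  -- the certificate lives in the subgraph `K = diagonal ∪ cells of F`
  set K : Finset (Fin n × Fin n) := G.filter fun e => e.1 = e.2 ∨ ∃ γ ∈ F, γ e.1 = e.2 with hK
  have hKG : K ⊆ G := Finset.filter_subset _ _
  have hKdiag : ∀ i, (i, i) ∈ K := fun i => Finset.mem_filter.2 ⟨hdiag i, Or.inl rfl⟩
  have hKmem : ∀ γ ∈ F, ∀ i, (i, γ i) ∈ K := fun γ hγ i =>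
    Finset.mem_filter.2 ⟨hFmem γ hγ i, Or.inr ⟨γ, hγ, rfl⟩⟩
  have hKnot : ¬ IsPfaffianBipartite K :=
    not_isPfaffianBipartite_of_certificate hKdiag F hFcyc hKmem heven hsign
  -- deletion-minimality: `K = G`, i.e. every arc of `G` is a cell of a member of `F`
  intro a b hab
  have habK : (a, b) ∈ K := by
    by_contra habK
    apply hKnot
    refine (hdel (a, b) hab.2).anti fun e he => Finset.mem_erase.2 ⟨?_, hKG he⟩
    rintro rfl
    exact habK he
  obtain ⟨-, h⟩ := Finset.mem_filter.1 habK
  rcases h with h | ⟨γ, hγ, hγab⟩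
  · exact absurd h hab.1
  have hne : γ a ≠ a := by rw [hγab]; exact hab.1.symm
  simp only [hF, List.mem_cons, List.mem_append] at hγ
  rcases hγ with rfl | rfl | hγ | hγ
  · exact Or.inl hγab
  · exact Or.inr (Or.inl hγab)
  · have hmem := (hΓ₁ γ hγ).2.2 a hne
    rw [hγab] at hmem
    rcases List.mem_append.1 hmem with h | h
    · exact Or.inl (apply_eq_of_mem_zip_tail_toList hA huv.1 hAu h)
    · exact Or.inr (Or.inr h)
  · have hmem := (hΓ₂ γ hγ).2.2 a hne
    rw [hγab] at hmem
    rcases List.mem_append.1 hmem with h | h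
    · exact Or.inr (Or.inl (apply_eq_of_mem_zip_tail_toList hB huv.1 hBu h))
    · exact Or.inr (Or.inr h)

/-- **The ear structure of a deletion-minimal non-Pfaffian bipartite graph** (Little 1975, §4;
Norine–Little–Teo). Let `G ⊇ diagonal` be non-Pfaffian with `G.erase e` Pfaffian for all
`e ∈ G`, and let `u → v` be an arc of `D(G, M)` whose deletion leaves `D(G, M)` strongly
connected. Then there are: a signing `s` (`+1` on the diagonal and on `(u, v)`) making every
directed circuit avoiding the cell `(u, v)` positive; directed circuits `A`, `B` through `u → v`
of weights `-1`, `+1`; and a directed path `S = u :: lS` from `u` to `v` avoiding the arc — such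
that **every arc `a → b` of `D(G, M)` is an arc of `A`, of `B` or of `S`**.
[cite: Little1975, §4] -/
theorem exists_ear_structure {G : Finset (Fin n × Fin n)} (hdiag : ∀ i, (i, i) ∈ G)
    (hG : ¬ IsPfaffianBipartite G) (hdel : ∀ e ∈ G, IsPfaffianBipartite (G.erase e))
    {u v : Fin n} (huv : IsArc G u v) (hstrong : IsStrong (G.erase (u, v))) :
    ∃ (s : Fin n × Fin n → ℤˣ) (A B : Perm (Fin n)) (lS : List (Fin n)),
      (∀ i, s (i, i) = 1) ∧ s (u, v) = 1 ∧
      (∀ γ : Perm (Fin n), γ.IsCycle → (∀ i, (i, γ i) ∈ G) → γ u ≠ v →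
        Perm.sign γ * ∏ i, s (i, γ i) = 1) ∧
      A.IsCycle ∧ (∀ i, (i, A i) ∈ G) ∧ A u = v ∧ Perm.sign A * ∏ i, s (i, A i) = -1 ∧
      B.IsCycle ∧ (∀ i, (i, B i) ∈ G) ∧ B u = v ∧ Perm.sign B * ∏ i, s (i, B i) = 1 ∧
      (u :: lS).IsChain (IsArc (G.erase (u, v))) ∧ (u :: lS).Nodup ∧
      (u :: lS).getLast (List.cons_ne_nil _ _) = v ∧
      ∀ a b, IsArc G a b → A a = b ∨ B a = b ∨ (a, b) ∈ (u :: lS).zip lS := by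
  obtain ⟨s, A, B, h1, hsuv, hpos, hA, hAmem, hAu, hAw, hB, hBmem, hBu, hBw⟩ :=
    exists_opposite_pair hdiag hG huv.1 (hdel _ huv.2)
  obtain ⟨lS, hSchain, hSnd, hSlast⟩ := hstrong.exists_path u v
  exact ⟨s, A, B, lS, h1, hsuv, hpos, hA, hAmem, hAu, hAw, hB, hBmem, hBu, hBw, hSchain, hSnd,
    hSlast, covering_of_triple hdiag hdel huv h1 hpos hA hAmem hAu hAw hB hBmem hBu hBw hSchain
      hSlast⟩

end Literature.Combinatorics.SimpleGraph
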